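import Literature.MathematicalPhysics.QuantumFieldTheory.Balaban1983to89.Beta.ConstraintElimination
import Literature.MathematicalPhysics.QuantumFieldTheory.Balaban1983to89.Beta.Composition

/-!
# `BalabanUV.Beta.D1BFx.GhostSchur` — road «BF-x» for binder row D1, leaf R3 (model level): THE GHOST SCHUR SPLIT
# `det(Oᵀ M² O) · det(Q Qᵀ) = (det M)² · det(Q M⁻² Qᵀ)` for an orthonormal basis `O` of `ker Q`

HONEST FRAMING (cell contract, verbatim): «discharging `BetaPertH` makes Bałaban's UV stability UNCONDITIONAL — a real constructive-QFT
result; it is NOT the continuum limit and NOT the Clay problem.»  This module is [folklore] finite-dimensional linear algebra over a field /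
over `ℝ`; it cites nothing, mints no `Prop`, discharges nothing of the wall.  NOT summit progress.

WHY (skeleton `HOME/beta/skeletons/D1-b2b-balaban-beta-d1-p2.md`, NODE R, leaf R3; AN2.md §8.9 «(G-identity)», which the an2 lineage checked in
exact rational arithmetic on a random instance and which is PROVED here).  In the background-Feynman representation of the one-shot orbit
functional the R-slice Faddeev–Popov logarithm is `log|det(M↾𝔫 → M𝔫)|` for a symmetric invertible operator `M` (the evaluation-type ghost
operator) restricted to the residual algebra `𝔫 = ker Q` (zero coarse data), the determinant taken in orthonormal bases: `½·log det(Oᵀ M² O)`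
for an orthonormal basis `O` of `ker Q`.  The identity below rewrites it as `log|det M| + ½·log det(Q M⁻² Qᵀ) − ½·log det(Q Qᵀ)`: a FINE bulk
log-det (the ghost loop proper), a UNIT-lattice log-det and a `B`-free Gram term — the three pieces the skeleton's node A treats separately.

CONTENT (all [folklore]).
* `det_fromCols_kernelBasis_transpose_sq` : `det [O | Qᵀ]² = det(Q Qᵀ)` when `Q O = 0`, `Oᵀ O = 1`.
* `det_gram_kernelBasis_mul` : `det(Oᵀ (M M) O) · det(Q Qᵀ) = (det M)² · det(Q (M M)⁻¹ Qᵀ)` (any field; `M` invertible, `det(QQᵀ)` a unit).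
* `half_log_det_gram_kernelBasis` (over `ℝ`, with the three determinants positive): `½·log det(Oᵀ M² O) = log|det M| + ½·log det(Q M⁻² Qᵀ) −
  ½·log det(QQᵀ)`.
Tree inputs BY NAME: `ConstraintElimination.det_bordered_mul_det_basis_sq` (general-basis elimination Jacobian), `Composition.det_kkt'` (signed
Schur evaluation of the bordered determinant).
-/

namespace Summit.QuantumFields.BalabanUV.Beta.D1BFx.GhostSchur

open Matrix
open Literature.MathematicalPhysics.QuantumFieldTheory.Balaban1983to89.Beta
open Literature.MathematicalPhysics.QuantumFieldTheory.Balaban1983to89.Beta.ConstraintElimination (det_bordered_mul_det_basis_sq)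
open Literature.MathematicalPhysics.QuantumFieldTheory.Balaban1983to89.Beta.Composition (kkt blockProp det_kkt')

section Field

variable {𝕜 : Type*} [Field 𝕜]
variable {σ κ : Type*} [Fintype σ] [Fintype κ] [DecidableEq σ] [DecidableEq κ]

/-- [folklore] For `Q O = 0` and `Oᵀ O = 1`: `[O | Qᵀ]ᵀ [O | Qᵀ] = [[1, OᵀQᵀ],[0, QQᵀ]]`, hence `det [O | Qᵀ]² = det(Q Qᵀ)`. -/
theorem det_fromCols_kernelBasis_transpose_sq (Q : Matrix κ (σ ⊕ κ) 𝕜) (O : Matrix (σ ⊕ κ) σ 𝕜)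
    (hQO : Q * O = 0) (hOO : Oᵀ * O = 1) :
    (fromCols O Qᵀ).det ^ 2 = (Q * Qᵀ).det := by
  have h : (fromCols O Qᵀ)ᵀ * fromCols O Qᵀ = fromBlocks 1 (Oᵀ * Qᵀ) 0 (Q * Qᵀ) := by
    rw [transpose_fromCols, fromRows_mul_fromCols, transpose_transpose, hOO, hQO]
  have hdet := congrArg det h
  rw [det_mul, det_transpose, det_fromBlocks_zero₂₁, det_one, one_mul] at hdet
  rw [sq]
  exact hdet

/-- [folklore] **THE GHOST SCHUR SPLIT (determinant form).**  For an invertible `M` on `σ ⊕ κ`, a constraint `Q : κ × (σ ⊕ κ)` with `det(QQᵀ)` a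
unit, and an orthonormal basis `O` of `ker Q` (`Q O = 0`, `Oᵀ O = 1`):
`det(Oᵀ (M M) O) · det(Q Qᵀ) = (det M)² · det(Q (M M)⁻¹ Qᵀ)`. -/
theorem det_gram_kernelBasis_mul (M : Matrix (σ ⊕ κ) (σ ⊕ κ) 𝕜) (Q : Matrix κ (σ ⊕ κ) 𝕜) (O : Matrix (σ ⊕ κ) σ 𝕜)
    (hM : IsUnit M.det) (hQ : IsUnit (Q * Qᵀ).det) (hQO : Q * O = 0) (hOO : Oᵀ * O = 1) :
    (Oᵀ * (M * M) * O).det * (Q * Qᵀ).det = M.det ^ 2 * (Q * (M * M)⁻¹ * Qᵀ).det := by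
  have hMM : IsUnit (M * M).det := by rw [det_mul]; exact hM.mul hM
  have hQQ : IsUnit (Q * Qᵀ).det := hQ
  -- elimination Jacobian in the basis [O | Qᵀ]
  have h1 := det_bordered_mul_det_basis_sq (M * M) Q O Qᵀ hQO hQQ
  -- Schur evaluation of the bordered determinant
  have h2 : (fromBlocks (M * M) Qᵀ Q 0).det = (-1) ^ Fintype.card κ * ((M * M).det * (Q * (M * M)⁻¹ * Qᵀ).det) :=
    det_kkt' (M * M) Q hMM
  rw [h2, det_fromCols_kernelBasis_transpose_sq Q O hQO hOO, det_mul] at h1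
  -- cancel `(−1)^{|κ|}` and one factor `det(QQᵀ)`
  have hQne : (Q * Qᵀ).det ≠ 0 := hQQ.ne_zero
  have hsign : ((-1 : 𝕜) ^ Fintype.card κ) ≠ 0 := pow_ne_zero _ (neg_ne_zero.mpr one_ne_zero)
  have h3 : (-1 : 𝕜) ^ Fintype.card κ * ((Q * Qᵀ).det * (M.det * M.det * (Q * (M * M)⁻¹ * Qᵀ).det - (Oᵀ * (M * M) * O).det * (Q * Qᵀ).det)) = 0 := by
    have := h1
    ring_nf
    ring_nf at this
    linear_combination this
  rcases mul_eq_zero.mp h3 with h | h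
  · exact absurd h hsign
  rcases mul_eq_zero.mp h with h' | h'
  · exact absurd h' hQne
  · rw [sq]; exact (sub_eq_zero.mp h').symm

end Field

section Real

variable {σ κ : Type*} [Fintype σ] [Fintype κ] [DecidableEq σ] [DecidableEq κ]

/-- [folklore] **THE GHOST SCHUR SPLIT (logarithmic form, AN2 §8.9 (G-identity)).**  Over `ℝ`, with the three determinants positive (they are Gram /
Schur determinants of full-rank real matrices): `½·log det(Oᵀ M² O) = log|det M| + ½·log det(Q M⁻² Qᵀ) − ½·log det(Q Qᵀ)`. -/
theorem half_log_det_gram_kernelBasis (M : Matrix (σ ⊕ κ) (σ ⊕ κ) ℝ) (Q : Matrix κ (σ ⊕ κ) ℝ) (O : Matrix (σ ⊕ κ) σ ℝ)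
    (hM : M.det ≠ 0) (hQO : Q * O = 0) (hOO : Oᵀ * O = 1)
    (hG : 0 < (Oᵀ * (M * M) * O).det) (hQQ : 0 < (Q * Qᵀ).det) (hS : 0 < (Q * (M * M)⁻¹ * Qᵀ).det) :
    (1 / 2 : ℝ) * Real.log (Oᵀ * (M * M) * O).det
      = Real.log |M.det| + (1 / 2 : ℝ) * Real.log (Q * (M * M)⁻¹ * Qᵀ).det - (1 / 2 : ℝ) * Real.log (Q * Qᵀ).det := by
  have h := det_gram_kernelBasis_mul M Q O (isUnit_iff_ne_zero.mpr hM) (isUnit_iff_ne_zero.mpr hQQ.ne') hQO hOO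
  have hlog := congrArg Real.log h
  rw [Real.log_mul hG.ne' hQQ.ne', Real.log_mul (pow_ne_zero 2 hM) hS.ne', ← Real.log_abs (M.det ^ 2), abs_pow,
    Real.log_pow] at hlog
  push_cast at hlog
  linarith

end Real

end Summit.QuantumFields.BalabanUV.Beta.D1BFx.GhostSchur
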